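import Summits.HodgeConjecture.HodgeConjecture.Theorems.F0P3cDbTThetaOccurrenceLiuLocus   -- ★ §1–§4 (LH10-p02 p848642): (O1) on the Liu locus
import Summits.HodgeConjecture.HodgeConjecture.Theorems.R90S9InnerFormSec146Scope        -- ★ S9 scope: `IsKcSpherical` (K_c = `cmCompactFactor L ι H T hT`)
import Summits.HodgeConjecture.HodgeConjecture.Theorems.F0P3CompactTrivOfRecord           -- ★ p819716: `cmCompactFactor_rightRegular_eq_self_of_isHolOrAntihol`
import HarnessLib

/-!
# Crux `H413`, line LH10 «(D-b)ᵀ» — (O1-W1♮): the Liu-locus theta member AT THE GIVEN MEASURE is `K_c`-SPHERICAL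

Cell `hodgecm-mathlib` (D-0151), FLOOR 0, crux item H413 = `stmt-HodgeConjecture-24833`; squad F0∕P3c line LH10, junction J7-K with S9 (R90-IF):
S9's framed TOP (O2♮-K) `R90.S9.TopXiPacketRigidCoreScFramedKit` (`Cruxes/H413/Lines/R90_S9_InnerFormXiRigiditySockets.lean` §5, S9-J7 (3)) reads the
theta member's `K_c`-sphericality `IsKcSpherical L ι H T hT μA P`; the leaf's K-organ (O1-W1♮) `StubThetaLiftMemberW1K` (LH10 ED. 10 «J7-K») therefore
asks ★ §4 `stubThetaLiftMember_liuLocus` for TWO more clauses: the member at the GIVEN automorphic measure `μA` (§4's proof already witnesses it there)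
and `IsKcSpherical` of that member.  THIS FILE pays both, hypothesis-free on the Liu locus, with ZERO new mathematics: §2's occurrence engine ★ OCC♭∀
`F0P2sOccFlatAllOfThetaOccursIn.stubOccFlatAll_of_thetaOccursInGen` (∘ ★ Θ-OCC-GEN) already produces the discrete `P` TOGETHER WITH its cotangent type
`P.IsHolCotangentAt (cmArchSection …) (cmCompactFactor …) ∨ P.IsAntiholCotangentAt … …` (§2 discarded that conjunct); ★ p819716
`F0P3CompactTrivOfRecord.cmCompactFactor_rightRegular_eq_self_of_isHolOrAntihol` turns it into «`K_c` fixes `P.space` pointwise» = the BODY of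
`IsKcSpherical` [R90S9InnerFormSec146Scope :72–:77].  The rest is §3 (global pins) + §4's closers verbatim (★ S2♯-θ `memXiFamily_of_theta_of_clauses`,
★ (TCᴸ) `exists_and_forall_isConstituentOf_theta`).  Record side (szE1 (g4) census Q-J7K-2, 2026-09-04): the record's own binders force inf char(ξ_w) = ρ at
every compact `w` (★ `isCohTrivialAt_of_dictionary`), consistent with the member being `K_c`-spherical — outcome (i), no new Day-X datum.

THEOREMS ONLY (no `def`, no instance, no notation, no `sorry`); no `Cruxes/**` import; `--supports stmt-HodgeConjecture-24833`.
HONEST LABEL: HC_CM is proved only modulo the 7 printed citations (2 remaining named inputs: hLiu418 = stmt-HodgeConjecture-24832, h413 = stmt-HodgeConjecture-24833)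
until rung 0 closes; this file pays the K-organ (O1-W1♮) of the LH10 leaf ON THE LIU LOCUS ONLY; REL ≠ ★ ≠ BUILT.

## References
* [GelbartRogawski1991] S. Gelbart, J. Rogawski, Invent. Math. 105 (1991): §3.4 Prop. 3.4.1 pp. 459–460, Thm. 3.4 (a) p. 461; Lem. 5.1.2 p. 466.
* [Rogawski1990] J. Rogawski, Ann. of Math. Stud. 123 (1990): §12.3; §13.1 Prop. 13.1.3 (d) p. 199; §14.6 pp. 242–245; §15.3 ¶1.
* [BorelJacquet1979] A. Borel, H. Jacquet, Proc. Sympos. Pure Math. 33.1 (1979), §4.6.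
* [Liu2021] Y. Liu, Camb. J. Math. 9 (2021): Def. 4.11 (l. 2090–2096), Def. 4.12, Prop. 4.13 (l. 2145–2149); App. D §D.1, Lem. D.1 (1).
-/

set_option autoImplicit false
-- the mandated namespace repeats the single-problem summit's segment (`HodgeConjecture.HodgeConjecture`)
set_option linter.dupNamespace false

noncomputable section

open scoped Matrix Kronecker MatrixGroups MonoidAlgebra ComplexOrder
open NumberField NumberField.InfinitePlace IsDedekindDomain MeasureTheory
open Literature.NumberTheory Literature.NumberTheory.Automorphic Literature.NumberTheory.Automorphic.UnitaryGroup
open Literature.NumberTheory.Automorphic.Liu2021 Literature.NumberTheory.Automorphic.Liu2021.AppendixC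
open Literature.NumberTheory.Automorphic.Liu2021.Def411WeilCarriers
open Literature.NumberTheory.Automorphic.Liu2021.Def411WeilCarriersDoubling
open Literature.NumberTheory.Automorphic.Liu2021.CheckOfChi
open Literature.NumberTheory.Automorphic.IdeleClassGroup
open Literature.NumberTheory.GelbartRogawski1991 Literature.NumberTheory.GelbartRogawski1991.UnitaryDualPair
open Literature.NumberTheory.GelbartRogawski1991.UnitaryDualPair.WeilCoinv
open Literature.NumberTheory.GelbartRogawski1991.UnitaryDualPair.LocalSplitting
open Literature.RepresentationTheory Literature.RepresentationTheory.Liu2021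
open Literature.NumberTheory.GaloisRepresentations Literature.RepresentationTheory.HarrisKudlaSweet1996
open Literature.NumberTheory.Rogawski1990
open Literature.AlgebraicGeometry.Liu2021 (IsAdmissibleElement)
open Summit.HodgeConjecture.CorCM
open Summit.HodgeConjecture.CorCM.Transposition
open Summit.HodgeConjecture.HodgeConjecture.Cruxes.H413

open Summit.HodgeConjecture.HodgeConjecture.Cruxes.H413.F0P3cDbTThetaOccurrenceLiuLocus
open Summit.HodgeConjecture.HodgeConjecture.R90.S9.InnerFormSec146 (IsKcSpherical)

namespace Summit.HodgeConjecture.HodgeConjecture.Cruxes.H413.F0P3cDbTThetaOccurrenceLiuLocusKc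

set_option synthInstance.maxHeartbeats 400000 in
set_option maxHeartbeats 16000000 in
/-- **(O1-W1♮) ON THE LIU LOCUS — the theta member AT THE GIVEN MEASURE, `K_c`-SPHERICAL.**  Same binders as ★ §4 `stubThetaLiftMember_liuLocus`; conclusion =
its conclusion with `∃ μA (_ : IsAutomorphicMeasure μA)` instantiated at the GIVEN `μA` and the extra conjunct `IsKcSpherical L ι H T hT μA P` — TOKEN FOR TOKEN the
K-organ `StubThetaLiftMemberW1K` of the LH10 leaf ED. 10 at `χ := ⟨χ_f, haut⟩`.  Proof: §2 inlined keeping ★ OCC♭∀'s cotangent disjunct, ★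
`cmCompactFactor_rightRegular_eq_self_of_isHolOrAntihol`, §3, §4's closers.
[cite: GelbartRogawski1991, §3.4 Prop. 3.4.1 pp. 459–460, Thm. 3.4 (a) p. 461; Lem. 5.1.2 p. 466] [cite: Rogawski1990, §13.1 Prop. 13.1.3 (d) p. 199; §15.3 ¶1]
[cite: BorelJacquet1979, §4.6] [cite: Liu2021, Prop. 4.13 (l. 2145–2149); App. D Lem. D.1 (1)] -/
theorem stubThetaLiftMember_liuLocus_kc
    (L : Type) [Field L] [NumberField L] [IsCMField L] (ι : L →+* ℂ) (H : Matrix (Fin 3) (Fin 3) L) (T : GL (Fin 3) ℂ)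
    (hT : (T : Matrix (Fin 3) (Fin 3) ℂ)ᴴ * H.map ι * (T : Matrix (Fin 3) (Fin 3) ℂ) = Literature.Geometry.ComplexHyperbolic.BallModel.J)
    (hdef : ∀ τ' : L →+* ℂ, InfinitePlace.mk τ' ≠ InfinitePlace.mk ι → (H.map τ').PosDef) (h2 : 2 ≤ Module.finrank ℚ ↥(maximalRealSubfield L))
    (hH : (H.map (cmConjRingHom L))ᵀ = H) (hHd : IsUnit H.det) (μω : HeckeCharacter L) (hμu : μω.IsUnitary)
    (hμω : ∀ x : Literature.NumberTheory.GaloisRepresentations.ideleGroup ↥(maximalRealSubfield L),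
      μω (AdeleRing.ideleBaseChange (↥(maximalRealSubfield L)) L x) = quadraticHeckeCharCM L x)
    {n' : ℕ} (e₁ : Fin 3 × Fin 1 ≃ Fin n') (dV : Fin 3 → L) (hdV : ∀ i, IsCMField.complexConj L (dV i) = dV i) (hdV0 : ∀ i, dV i ≠ 0)
    (g : GL (Fin 3) L) (hg : ((g : Matrix (Fin 3) (Fin 3) L).map (cmConjRingHom L))ᵀ * H * (g : Matrix (Fin 3) (Fin 3) L) = Matrix.diagonal dV)
    (ξ : OneDimAutRepH L)
    (μ : Literature.NumberTheory.Automorphic.IdeleClassGroup L →ₜ* Circle) (hμ : IsConjugateSymplectic L μ)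
    (χf : UnitaryGroup.finAdelicOne (↥(maximalRealSubfield L)) L (IsCMField.complexConj L) →* ℂˣ)
    (hD1 : ∀ v : HeightOneSpectrum (𝓞 ↥(maximalRealSubfield L)),
      (toHeckeCharacter L μ).semilocalComponent L v = (ξ.bcη⁻¹ * ξ.bcψ⁻¹ * μω).semilocalComponent L v)
    (hD2 : ∀ z : (FiniteAdeleRing (𝓞 L) L)ˣ,
      χf (finAdelicCheck (↥(maximalRealSubfield L)) L (IsCMField.complexConj L)
          (AlgEquiv.ext fun x => by rw [AlgEquiv.mul_apply, IsCMField.complexConj_apply_apply, AlgEquiv.one_apply]) z) =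
        (ξ.bcψ⁻¹ * (ξ.bcη⁻¹ * ξ.bcψ⁻¹ * μω) ^ 2)
          (Units.map (N := AdeleRing (𝓞 L) L) (MonoidHom.inr (InfiniteAdeleRing L) (FiniteAdeleRing (𝓞 L) L)) z))
    -- the LIU LOCUS
    (μA : Measure (adelicGroupData (↥(maximalRealSubfield L)) L (IsCMField.complexConj L) 3 H).automorphicQuotient)
    [hμA : (adelicGroupData (↥(maximalRealSubfield L)) L (IsCMField.complexConj L) 3 H).IsAutomorphicMeasure μA]
    (hw : HasWeight L μ 1) (χ : Chi (↥(maximalRealSubfield L)) L (IsCMField.complexConj L)) (hχ : χ.1 = χf)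
    (v : HeightOneSpectrum (𝓞 ↥(maximalRealSubfield L))) (hv : ∀ w : PlacesOver L v, IsCMField.complexConj L • w.1 = w.1) :
    ∃ (ε : (↥(maximalRealSubfield L))ˣ)
      (P : DiscreteAutomorphicRep (adelicGroupData (↥(maximalRealSubfield L)) L (IsCMField.complexConj L) 3 H) μA),
      MemXiFamily P hH hHd μω hμu ξ ∧
      IsKcSpherical L ι H T hT μA P ∧
      (∃ c : IrrClass ((cmDatum L 3 H).Local v),
        (IrrClass.comap (localPiEquiv L (IsCMField.complexConj L) 3 H v) c).IsConstituentOf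
          (P.finRep.smoothPart.toRepresentation.comp (inclPlace (↥(maximalRealSubfield L)) L (IsCMField.complexConj L) 3 H v))) ∧
      ∀ c : IrrClass ((cmDatum L 3 H).Local v),
        (IrrClass.comap (localPiEquiv L (IsCMField.complexConj L) 3 H v) c).IsConstituentOf
            (P.finRep.smoothPart.toRepresentation.comp (inclPlace (↥(maximalRealSubfield L)) L (IsCMField.complexConj L) 3 H v)) →
          c.IsSupercuspidal ∧ ThetaTypeAtCM L H e₁ dV hdV hdV0 g hg μ hμ χf ε v c := by
  subst hχ
  -- the frame transport `ιV := g_f⁻¹ · g_f` (§4 verbatim)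
  let ιV : finAdelic (↥(maximalRealSubfield L)) L (IsCMField.complexConj L) 3 H →*
      finAdelic (↥(maximalRealSubfield L)) L (IsCMField.complexConj L) 3 (Matrix.diagonal dV) :=
    ((UnitaryGroup.finAdelicCongr (↥(maximalRealSubfield L)) L (IsCMField.complexConj L) g one_ne_zero
      (show formCongr (IsCMField.complexConj L : L →+* L) g ((1 : L) • H) = Matrix.diagonal dV by rw [one_smul]; exact hg)).symm :
        _ ≃ₜ* _).toMonoidHom
  have hιV : ∀ k, ((ιV k : finAdelic (↥(maximalRealSubfield L)) L (IsCMField.complexConj L) 3 (Matrix.diagonal dV)) :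
      GL (Fin 3) (FiniteAdeleRing (𝓞 L) L)) =
      (toFinAdeleGL L 3 g)⁻¹ * (k : GL (Fin 3) (FiniteAdeleRing (𝓞 L) L)) * toFinAdeleGL L 3 g := fun k => rfl
  -- §2 verbatim, KEEPING the cotangent type of the member
  haveI : Algebra.IsQuadraticExtension ↥(maximalRealSubfield L) L := IsCMField.isQuadraticExtension L
  -- `δ := (2i)⁻¹` is purely imaginary and non-zero
  have hδ0 : ((2 : L) * imagUnit L)⁻¹ ≠ 0 := inv_ne_zero (mul_ne_zero two_ne_zero (imagUnit_ne_zero L))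
  have hδ : IsCMField.complexConj L (((2 : L) * imagUnit L)⁻¹) = -((2 : L) * imagUnit L)⁻¹ := by
    rw [map_inv₀, map_mul, map_ofNat, complexConj_imagUnit, mul_neg, inv_neg]
  obtain ⟨a, hadm, hsc⟩ := exists_admissibleLine_isSupercuspidal_xThetaCM L e₁ dV hdV hdV0 μ hμ χ.1 χ.2.1 (Def411WeilCarriers.norm_chi_eq_one_cm L χ)
    hμ.cmType.1 (fun φ hφ => (hμ.cmType.2 φ).mp hφ) hδ hδ0 v hv
  have hadm' : ∃ e : L, IsAdmissibleElement L hμ.cmType.1 e ∧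
      epsOf (↥(maximalRealSubfield L)) (imagUnitSq L) L (2 * imagUnit L)⁻¹ e = locF (↥(maximalRealSubfield L)) (imagUnitSq L) a :=
    ⟨_, hadm, epsOf_algebraMap_mul (↥(maximalRealSubfield L)) (imagUnitSq L) L ((2 : L) * imagUnit L)⁻¹ hδ0 a⟩
  obtain ⟨P, hcot, hfin⟩ := F0P2sOccFlatAllOfThetaOccursIn.stubOccFlatAll_of_thetaOccursInGen F0P2tThetaOccursInGenNeg.thetaOccursInGen
    L ι H T hT hdef h2 e₁ dV hdV hdV0 g hg ιV hιV μA μ hμ hw a χ hadm'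
  -- §3: the two global pins
  obtain ⟨hμξ, hχξ⟩ := globalPins_of_dict L ξ μω μ χ hD1 hD2
  refine ⟨a, P, ?_, ?_, F0P3cDbTThetaConstituents.exists_and_forall_isConstituentOf_theta L H e₁ dV hdV hdV0 g hg ιV hιV
    μA P μ hμ a χ hfin v hsc⟩
  · exact F0P2uS2SharpTheta.memXiFamily_of_theta_of_clauses L H hH hHd e₁ dV hdV hdV0 g hg ιV hιV μA P ξ μω hμu μ hμ a χ
      (Def411WeilCarriers.complexConj_mul_complexConj' L) hμξ hχξ hfin
      (fun w hw' => F0P2uMemXiFamilyThetaNonsplit.nonsplit_clause_of_hasFinComponent_theta L H hH hHd e₁ dV hdV hdV0 g hg ιV hιV μA P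
        μω hμu hμω μ hμ a χ hfin ξ (Def411WeilCarriers.complexConj_mul_complexConj' L) hμξ hχξ w hw')
  · -- `K_c` fixes the cotangent member pointwise (★ p819716) = the body of `IsKcSpherical`
    intro k hk w hw'
    exact F0P3CompactTrivOfRecord.cmCompactFactor_rightRegular_eq_self_of_isHolOrAntihol L ι H T hT P hcot k hk ⟨w, hw'⟩

end Summit.HodgeConjecture.HodgeConjecture.Cruxes.H413.F0P3cDbTThetaOccurrenceLiuLocusKc

end
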